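import Summits.QuantumFields.YangMills.Theorems.UnitScaleTiltProp7ChartGaugeCovariance
import Summits.QuantumFields.YangMills.Theorems.UnitScaleTiltProp7SymFrameGaugeResponseAt
import HarnessLib

/-!
# (q-gauge) SUPPLIER, §2 — **THE FIRST-ORDER GAUGE COVARIANCE OF `log U̿^{twS}` AT A GENERAL CHART POINT**:
# `D(logChartTwS U₀)(A)[V] (c) = Dlog(U̿^{twS}(A)(c))[κ(ĉ₋)·U̿^{twS}(A)(c) − U̿^{twS}(A)(c)·Ū₀(ĉ)κ(ĉ₊)Ū₀(ĉ)⁻¹]`, `κ = Ad_{v_A⁻¹}(N∘x̂⁽ᵏ⁾ − v̇_A v_A⁻¹)`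
# — the `t`-derivative of §1 ✓`Prop7ChartGaugeCovariance.dbarTwS_eq_of_gaugeActT` along a gauge family `g_t` (`ġ_0 = N`), modulo the FRAME RESPONSE `v̇_A` (FR₁) and the
# derivative of `log` at the double bar ([Balaban1985BackgroundPropagators] (3.114)–(3.115) p.418, (3.19) p.393; [Balaban1985Averaging] (11), (97))

Cell `ym3-torus` (HUMAN RULING D-0037, YM ladder rung R3 — SU(2) YM₃ on T³: NOT d = 4, NOT infinite volume, NOT a mass gap, NOT Clay).  Width seat `ym3-torus-px19` (gen 14);
chair ★`ym-ust-19200-p1` g27 WORD №29 (2) «(q-gauge) → px19 g14: GO»; px19 g14 LOCATE-S1 (2), first step.  THEOREMS ONLY (0 `def`, 0 `sorry`, default heartbeats);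
`--supports stmt-QuantumFields-19200 --as helper`; count-neutral; NO claim on crux ∕ stub ∕ registry.

THE PRINT.  [Balaban1985BackgroundPropagators] p. 393 (3.19), p. 418 (3.114)–(3.115) «Q_j(D_Uλ) = D_{U_j}(Q′_jλ)» — the infinitesimal gauge covariance of the averaging AT THE BACKGROUND
(tree: ✓`Prop7SymAvgTwSGaugeDir.QTwS_gaugeDir_of_avgSeq`).  THIS FILE: the same AT A GENERAL CHART POINT `A` (field `U′ = e^{A}U₀`), where the frames against the fixed `U₀` respond
by FR₁ (✓`Prop7SymFrameGaugeResponseAt`): differentiating §1's exact law `U̿^{twS}(A_t)(c) = k_t(ĉ₋)·U̿^{twS}(A)(c)·Ū₀(ĉ)k_t(ĉ₊)⁻¹Ū₀(ĉ)⁻¹` (`k_t = v_t⁻¹·(g_t∘x̂)·v_A`, `k_0 = 1`) at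
`t = 0` and comparing with the chain rule through the (analytic) chart gives the title; `κ := k̇_0 = v_A⁻¹(N∘x̂⁽ᵏ⁾ − v̇_A v_A⁻¹)v_A` is FR₁'s frame-corrected `ω`.  The second-order
identity of LOCATE-S1 (2) (the «gauge-spike» row `hqG` of ✓⧗`Prop7TJDivRowOfColumns`) is the `Y`-derivative of THIS identity at `A = 0`.

WHAT IS PROVED (ns `…Theorems.Prop7ChartGaugeCovarianceDeriv`; member `F`, `h : n ≤ K`, background `U₀`, chart point `A`, fine parameter `N`).
* §1 `gaugeActT_one_fun'` (`V^{1} = V`), `hasDerivAt_coe_k` (the derivative `κ` of `t ↦ k_t(x) = v_t(x)⁻¹·g_t(x̂x)·v_A(x)` at `0` from the frame response `v̇`), `k_zero` (`k_0 = 1`),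
  `hasDerivAt_coe_k_inv` (`d∕dt|₀ k_t(x)⁻¹ = −κ(x)`).
* §2 ★★★ `fderiv_logChartTwS_gaugeVelocity_apply` — THE TITLE: with DISPLAYED letters (i) `hS : DifferentiableAt ℂ (logChartTwS U₀) A` (✓`analyticOnNhd_logChartTwS` on the chart ball),
  (ii) the chart curve `Ac : ℝ → chart` of the gauge copies through `A` (`Ac 0 = A`, velocity `V`, and EVENTUALLY `e^{Ac t}U₀♭ = (e^{A}U₀♭)^{g_t}` — the `mlog` curve of
  ✓`Prop7QSymGaugeCovariance.expUnit_chartCurve_eventually` type), (iii) the gauge family `g` (`g_0 = 1`, `ġ_0 = N`), (iv) the top-level frame response `v̇` along `(e^{A}U₀♭)^{g_t}`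
  (FR₁ ✓`hasDerivAt_frameAccU_succ_at`, iterated), (v) the derivative `L_c` of `mlog` at the double bar `U̿^{twS}(A)(c)` (✓`hasFDerivAt_mlog_injective`-class, `‖U̿ − 1‖ < 1`):
  `fderiv ℂ (logChartTwS U₀) A V c = L_c (κ(ĉ₋)·D_c − D_c·(Ū₀(ĉ)·κ(ĉ₊)·Ū₀(ĉ)⁻¹))`, `D_c = U̿^{twS}(A)(c)`.
HYP-SAT (★★OWNER RULING №42): (i) theorem at `RegPr` backgrounds on the ball (✓W5); (ii)–(iii) inhabited by the explicit `mlog` curve (at `A = 0` this is ✓`QTwS_gaugeDir_of_frameResponse`'s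
own construction); (iv) FR₁; (v) ✓`hasFDerivAt_mlog_injective` under ✓`norm_dbarTwS_sub_one_lt_one_of_regPr`.  Conclusion is an EQUALITY — non-vacuous; no `Prop` placeholder.
HONEST SCOPE.  Chain-rule bookkeeping over §1 and FR₁'s letters; no estimate; nothing of (q-gauge), `hqG`, norm_G, the 8 EX rows, EX, the crux or rung R3 is proved; the Yang–Mills mass
gap is NOT proved.

References: T. Bałaban, CMP **99** (1985) 389–434 [Balaban1985BackgroundPropagators] ((3.19) p.393, (3.114)–(3.115) p.418); CMP **98** (1985) 17–51 [Balaban1985Averaging] ((11) p.19,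
(89)–(92) p.31, (97) p.32).
-/

set_option autoImplicit false

noncomputable section

open scoped Matrix.Norms.L2Operator Topology
open Filter NormedSpace

namespace Summit.QuantumFields.YangMills.Theorems.Prop7ChartGaugeCovarianceDeriv

open Literature.MathematicalPhysics.QuantumFieldTheory.Balaban1983to89
open Literature.MathematicalPhysics.QuantumFieldTheory.Balaban1983to89.T3ContinuumYM3Torus
open MatrixLog (mlog)
open B10Eq27TorusAxialLog (gaugeActT gaugeActT_apply)
open B7Prop1Explicit (expUnit)
open B15DeterminingSets (embIter)
open T3LevelShift (bondShift)
open T3PrintedRegularOrbits (sites_eq)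
open T3SectALandauChart (bgUnits)
open Summit.QuantumFields.YangMills.Theorems.Prop8Chart (emlIterU)
open Summit.QuantumFields.YangMills.Theorems.Prop7SymAvgTwSym (frameAccU dbarTwS logChartTwS logChartTwS_apply)
open Summit.QuantumFields.YangMills.Theorems.Prop7SymFrameGaugeResponseAt (hasDerivAt_units_inv)
open Summit.QuantumFields.YangMills.Theorems.Prop7ChartGaugeCovariance (dbarTwS_eq_of_gaugeActT)

/-! ## §1 Letters: the trivial gauge action, and the derivative of the frame-corrected coarse map `k_t` -/

section Letters

variable {P : Params} {𝔸 : Type*} [NormedRing 𝔸] [NormedAlgebra ℂ 𝔸] [CompleteSpace 𝔸]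

omit [NormedAlgebra ℂ 𝔸] [CompleteSpace 𝔸] in
/-- The trivial gauge map acts trivially. [cite: Balaban1985Averaging, (8) p.19] -/
theorem gaugeActT_one_fun' {k : ℕ} (V : GaugeField P k 𝔸ˣ) : gaugeActT (fun _ : Site P k => (1 : 𝔸ˣ)) V = V := by
  funext b
  rw [gaugeActT_apply, inv_one, one_mul, mul_one]

/-- **THE DERIVATIVE OF `t ↦ k_t = v_t⁻¹·ĝ_t·v` AT `0`**: for unit-valued curves `v_t` (`v_0 = v`, `v̇_0 = vd`) and `ĝ_t` (`ĝ_0 = 1`, `d∕dt|₀ ĝ = Nh`),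
`d∕dt|₀ (v_t⁻¹·ĝ_t·v) = v⁻¹·(Nh − vd·v⁻¹)·v`. [folklore] -/
theorem hasDerivAt_coe_k {vt gt : ℝ → 𝔸ˣ} {v : 𝔸ˣ} {vd Nh : 𝔸} (hv0 : vt 0 = v) (hg0 : gt 0 = 1)
    (hvd : HasDerivAt (fun t : ℝ => ((vt t : 𝔸ˣ) : 𝔸)) vd 0) (hgd : HasDerivAt (fun t : ℝ => ((gt t : 𝔸ˣ) : 𝔸)) Nh 0) :
    HasDerivAt (fun t : ℝ => ((((vt t)⁻¹ * gt t * v : 𝔸ˣ)) : 𝔸)) (((v⁻¹ : 𝔸ˣ) : 𝔸) * (Nh - vd * ((v⁻¹ : 𝔸ˣ) : 𝔸)) * (v : 𝔸)) 0 := by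
  have hinv := hasDerivAt_units_inv (h := vt) hvd
  rw [hv0] at hinv
  have h := (hinv.mul hgd).mul_const (v : 𝔸)
  have hfun : (fun t : ℝ => ((((vt t)⁻¹ * gt t * v : 𝔸ˣ)) : 𝔸)) = fun t : ℝ => (((vt t)⁻¹ : 𝔸ˣ) : 𝔸) * ((gt t : 𝔸ˣ) : 𝔸) * (v : 𝔸) := by
    funext t; simp only [Units.val_mul]
  rw [hfun]
  refine h.congr_deriv ?_
  simp only [hv0, hg0, Units.val_one, mul_one]
  noncomm_ring

omit [NormedAlgebra ℂ 𝔸] [CompleteSpace 𝔸] in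
/-- `k_0 = v⁻¹·1·v = 1`. [folklore] -/
theorem k_zero {vt gt : ℝ → 𝔸ˣ} {v : 𝔸ˣ} (hv0 : vt 0 = v) (hg0 : gt 0 = 1) : (vt 0)⁻¹ * gt 0 * v = 1 := by
  rw [hv0, hg0, mul_one, inv_mul_cancel]

/-- **THE DERIVATIVE OF `t ↦ k_t⁻¹` AT `0` IS `−κ`** (`k_0 = 1`). [folklore] -/
theorem hasDerivAt_coe_k_inv {vt gt : ℝ → 𝔸ˣ} {v : 𝔸ˣ} {vd Nh : 𝔸} (hv0 : vt 0 = v) (hg0 : gt 0 = 1)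
    (hvd : HasDerivAt (fun t : ℝ => ((vt t : 𝔸ˣ) : 𝔸)) vd 0) (hgd : HasDerivAt (fun t : ℝ => ((gt t : 𝔸ˣ) : 𝔸)) Nh 0) :
    HasDerivAt (fun t : ℝ => (((((vt t)⁻¹ * gt t * v)⁻¹ : 𝔸ˣ)) : 𝔸)) (-(((v⁻¹ : 𝔸ˣ) : 𝔸) * (Nh - vd * ((v⁻¹ : 𝔸ˣ) : 𝔸)) * (v : 𝔸))) 0 := by
  have hk := hasDerivAt_coe_k hv0 hg0 hvd hgd
  have h := hasDerivAt_units_inv (h := fun t => (vt t)⁻¹ * gt t * v) hk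
  have h1 : ((vt 0)⁻¹ * gt 0 * v)⁻¹ = 1 := by rw [k_zero hv0 hg0, inv_one]
  rw [h1, Units.val_one, one_mul, mul_one] at h
  exact h

end Letters

/-! ## §2 The first-order identity at a general chart point -/

section Member

variable {F : T3Family} {n K : ℕ} {h : n ≤ K}

/-- ★★★ **FIRST-ORDER GAUGE COVARIANCE OF `log U̿^{twS}` AT A GENERAL CHART POINT.**  Let `U₀` be a background, `A` a chart point at which the twisted log-chart is differentiable
(`hS`), `g : ℝ → (sites → GL₂)` a gauge family with `g_0 = 1`, `ġ_0 = N`, `Ac : ℝ → chart` a curve through `A` with velocity `V` whose points are, for small `t`, the chart coordinates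
of the gauge copies `(e^{A}U₀♭)^{g_t}` (`hcopy`), `vd` the response of the top-level accumulated frames of `(e^{A}U₀♭)^{g_t}` against `U₀♭` (FR₁), and `L c` the derivative of `mlog`
at the double bar `U̿^{twS}(A)(c)`.  Then, with `v x := frameAccU (K−n) U₀♭ (e^{A}U₀♭) x`, `κ x := v(x)⁻¹·(N(x̂⁽ᵏ⁾x) − vd(x)·v(x)⁻¹)·v(x)`, `Ū₀ := emlIterU (K−n) U₀♭`, `ĉ := bondShift c`:
**`fderiv ℂ (logChartTwS U₀) A V c = L c (κ(ĉ₋)·U̿^{twS}(A)(c) − U̿^{twS}(A)(c)·(Ū₀(ĉ)·κ(ĉ₊)·Ū₀(ĉ)⁻¹))`** — at `A = 0` (`v = 1`, `vd = N∘x̂ − N⁽ᵏ⁾`, `κ = N⁽ᵏ⁾`, `U̿ = 1`, `L = id`)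
this is ✓`QTwS_gaugeDir_of_frameResponse`. [cite: Balaban1985BackgroundPropagators, (3.19) p.393, (3.114)–(3.115) p.418; Balaban1985Averaging, (11) p.19, (97) p.32] -/
theorem fderiv_logChartTwS_gaugeVelocity_apply (U₀ : GaugeField (F.P K) 0 (Matrix.specialUnitaryGroup (Fin 2) ℂ)) (A : PBond (F.P K) 0 → Matrix (Fin 2) (Fin 2) ℂ)
    (hS : DifferentiableAt ℂ (logChartTwS F n K h U₀) A)
    (N : Site (F.P K) 0 → Matrix (Fin 2) (Fin 2) ℂ) (g : ℝ → Site (F.P K) 0 → (Matrix (Fin 2) (Fin 2) ℂ)ˣ) (hg0 : g 0 = fun _ => 1)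
    (hgd : ∀ z : Site (F.P K) 0, HasDerivAt (fun t : ℝ => ((g t z : (Matrix (Fin 2) (Fin 2) ℂ)ˣ) : Matrix (Fin 2) (Fin 2) ℂ)) (N z) 0)
    (Ac : ℝ → PBond (F.P K) 0 → Matrix (Fin 2) (Fin 2) ℂ) (hAc0 : Ac 0 = A) {V : PBond (F.P K) 0 → Matrix (Fin 2) (Fin 2) ℂ} (hAcd : HasDerivAt Ac V 0)
    (hcopy : ∀ᶠ t : ℝ in 𝓝 0, (fun b : PBond (F.P K) 0 => expUnit (Ac t b) * bgUnits F K U₀ b) = gaugeActT (g t) (fun b => expUnit (A b) * bgUnits F K U₀ b))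
    {vd : Site (F.P K) (K - n) → Matrix (Fin 2) (Fin 2) ℂ}
    (hFr : ∀ x : Site (F.P K) (K - n), HasDerivAt (fun t : ℝ =>
      ((frameAccU (K - n) (bgUnits F K U₀) (gaugeActT (g t) (fun b => expUnit (A b) * bgUnits F K U₀ b)) x : (Matrix (Fin 2) (Fin 2) ℂ)ˣ) : Matrix (Fin 2) (Fin 2) ℂ)) (vd x) 0)
    (L : PBond (F.P n) 0 → (Matrix (Fin 2) (Fin 2) ℂ →L[ℂ] Matrix (Fin 2) (Fin 2) ℂ))
    (hL : ∀ c : PBond (F.P n) 0, HasFDerivAt (mlog : Matrix (Fin 2) (Fin 2) ℂ → Matrix (Fin 2) (Fin 2) ℂ) (L c) ((dbarTwS F n K h U₀ A c : (Matrix (Fin 2) (Fin 2) ℂ)ˣ) : Matrix (Fin 2) (Fin 2) ℂ))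
    (c : PBond (F.P n) 0) :
    fderiv ℂ (logChartTwS F n K h U₀) A V c
      = L c (((((frameAccU (K - n) (bgUnits F K U₀) (fun b => expUnit (A b) * bgUnits F K U₀ b) (bondShift (sites_eq F n K h) c).src)⁻¹ : (Matrix (Fin 2) (Fin 2) ℂ)ˣ) : Matrix (Fin 2) (Fin 2) ℂ)
              * (N (embIter (K - n) (bondShift (sites_eq F n K h) c).src)
                  - vd (bondShift (sites_eq F n K h) c).src * (((frameAccU (K - n) (bgUnits F K U₀) (fun b => expUnit (A b) * bgUnits F K U₀ b) (bondShift (sites_eq F n K h) c).src)⁻¹ : (Matrix (Fin 2) (Fin 2) ℂ)ˣ) : Matrix (Fin 2) (Fin 2) ℂ))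
              * ((frameAccU (K - n) (bgUnits F K U₀) (fun b => expUnit (A b) * bgUnits F K U₀ b) (bondShift (sites_eq F n K h) c).src : (Matrix (Fin 2) (Fin 2) ℂ)ˣ) : Matrix (Fin 2) (Fin 2) ℂ))
            * ((dbarTwS F n K h U₀ A c : (Matrix (Fin 2) (Fin 2) ℂ)ˣ) : Matrix (Fin 2) (Fin 2) ℂ)
          - ((dbarTwS F n K h U₀ A c : (Matrix (Fin 2) (Fin 2) ℂ)ˣ) : Matrix (Fin 2) (Fin 2) ℂ)
            * (((emlIterU (K - n) (bgUnits F K U₀) (bondShift (sites_eq F n K h) c) : (Matrix (Fin 2) (Fin 2) ℂ)ˣ) : Matrix (Fin 2) (Fin 2) ℂ)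
                * ((((frameAccU (K - n) (bgUnits F K U₀) (fun b => expUnit (A b) * bgUnits F K U₀ b) (bondShift (sites_eq F n K h) c).tgt)⁻¹ : (Matrix (Fin 2) (Fin 2) ℂ)ˣ) : Matrix (Fin 2) (Fin 2) ℂ)
                    * (N (embIter (K - n) (bondShift (sites_eq F n K h) c).tgt)
                        - vd (bondShift (sites_eq F n K h) c).tgt * (((frameAccU (K - n) (bgUnits F K U₀) (fun b => expUnit (A b) * bgUnits F K U₀ b) (bondShift (sites_eq F n K h) c).tgt)⁻¹ : (Matrix (Fin 2) (Fin 2) ℂ)ˣ) : Matrix (Fin 2) (Fin 2) ℂ))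
                    * ((frameAccU (K - n) (bgUnits F K U₀) (fun b => expUnit (A b) * bgUnits F K U₀ b) (bondShift (sites_eq F n K h) c).tgt : (Matrix (Fin 2) (Fin 2) ℂ)ˣ) : Matrix (Fin 2) (Fin 2) ℂ))
                * (((emlIterU (K - n) (bgUnits F K U₀) (bondShift (sites_eq F n K h) c))⁻¹ : (Matrix (Fin 2) (Fin 2) ℂ)ˣ) : Matrix (Fin 2) (Fin 2) ℂ))) := by
  -- abbreviations
  set W : PBond (F.P K) 0 → (Matrix (Fin 2) (Fin 2) ℂ)ˣ := fun b => expUnit (A b) * bgUnits F K U₀ b with hW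
  set ĉ : PBond (F.P K) (K - n) := bondShift (sites_eq F n K h) c with hĉ
  set v : Site (F.P K) (K - n) → (Matrix (Fin 2) (Fin 2) ℂ)ˣ := fun x => frameAccU (K - n) (bgUnits F K U₀) W x with hv
  set vt : ℝ → Site (F.P K) (K - n) → (Matrix (Fin 2) (Fin 2) ℂ)ˣ := fun t x => frameAccU (K - n) (bgUnits F K U₀) (gaugeActT (g t) W) x with hvt
  set E : (Matrix (Fin 2) (Fin 2) ℂ)ˣ := emlIterU (K - n) (bgUnits F K U₀) ĉ with hE
  set D : (Matrix (Fin 2) (Fin 2) ℂ)ˣ := dbarTwS F n K h U₀ A c with hD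
  -- the frame family at `t = 0` is the frame of `W`
  have hvt0 : ∀ x, vt 0 x = v x := by
    intro x; simp only [hvt, hv, hg0, gaugeActT_one_fun']
  have hg0x : ∀ x : Site (F.P K) 0, g 0 x = 1 := fun x => by rw [hg0]
  -- (1) the chain rule through the chart along the real curve `Ac`
  have hSA : HasFDerivAt (logChartTwS F n K h U₀) (fderiv ℂ (logChartTwS F n K h U₀) A) (Ac 0) := by rw [hAc0]; exact hS.hasFDerivAt
  have hchain := (hSA.restrictScalars ℝ).comp_hasDerivAt (0 : ℝ) hAcd
  have hchain_c : HasDerivAt (fun t : ℝ => logChartTwS F n K h U₀ (Ac t) c) (fderiv ℂ (logChartTwS F n K h U₀) A V c) 0 := by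
    have hp := (hasDerivAt_pi.1 hchain) c
    simpa only [Function.comp_apply, ContinuousLinearMap.coe_restrictScalars'] using hp
  -- (2) the explicit curve: by §1, eventually `logChartTwS U₀ (Ac t) c = mlog (k_t(ĉ₋) · D · (E · k_t(ĉ₊)⁻¹ · E⁻¹))`
  set kt : ℝ → Site (F.P K) (K - n) → (Matrix (Fin 2) (Fin 2) ℂ)ˣ := fun t x => (vt t x)⁻¹ * g t (embIter (K - n) x) * v x with hkt
  set m : ℝ → Matrix (Fin 2) (Fin 2) ℂ := fun t =>
    ((kt t ĉ.src : (Matrix (Fin 2) (Fin 2) ℂ)ˣ) : Matrix (Fin 2) (Fin 2) ℂ) * (D : Matrix (Fin 2) (Fin 2) ℂ)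
      * ((E : Matrix (Fin 2) (Fin 2) ℂ) * (((kt t ĉ.tgt)⁻¹ : (Matrix (Fin 2) (Fin 2) ℂ)ˣ) : Matrix (Fin 2) (Fin 2) ℂ) * ((E⁻¹ : (Matrix (Fin 2) (Fin 2) ℂ)ˣ) : Matrix (Fin 2) (Fin 2) ℂ)) with hm
  have hev : ∀ᶠ t : ℝ in 𝓝 0, logChartTwS F n K h U₀ (Ac t) c = mlog (m t) := by
    filter_upwards [hcopy] with t ht
    rw [logChartTwS_apply, dbarTwS_eq_of_gaugeActT U₀ (g t) A (Ac t) ht c, ht]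
    simp only [hm, hkt, hvt, hv, hW, hD, hE, hĉ, Units.val_mul]
    rfl
  -- (3) the derivative of the explicit curve
  have hk_s := hasDerivAt_coe_k (vt := fun t => vt t ĉ.src) (gt := fun t => g t (embIter (K - n) ĉ.src)) (v := v ĉ.src) (hvt0 _) (hg0x _) (hFr ĉ.src) (hgd _)
  have hk_t := hasDerivAt_coe_k_inv (vt := fun t => vt t ĉ.tgt) (gt := fun t => g t (embIter (K - n) ĉ.tgt)) (v := v ĉ.tgt) (hvt0 _) (hg0x _) (hFr ĉ.tgt) (hgd _)
  set Ks : Matrix (Fin 2) (Fin 2) ℂ := (((v ĉ.src)⁻¹ : (Matrix (Fin 2) (Fin 2) ℂ)ˣ) : Matrix (Fin 2) (Fin 2) ℂ)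
      * (N (embIter (K - n) ĉ.src) - vd ĉ.src * (((v ĉ.src)⁻¹ : (Matrix (Fin 2) (Fin 2) ℂ)ˣ) : Matrix (Fin 2) (Fin 2) ℂ)) * ((v ĉ.src : (Matrix (Fin 2) (Fin 2) ℂ)ˣ) : Matrix (Fin 2) (Fin 2) ℂ) with hKs
  set Kt : Matrix (Fin 2) (Fin 2) ℂ := (((v ĉ.tgt)⁻¹ : (Matrix (Fin 2) (Fin 2) ℂ)ˣ) : Matrix (Fin 2) (Fin 2) ℂ)
      * (N (embIter (K - n) ĉ.tgt) - vd ĉ.tgt * (((v ĉ.tgt)⁻¹ : (Matrix (Fin 2) (Fin 2) ℂ)ˣ) : Matrix (Fin 2) (Fin 2) ℂ)) * ((v ĉ.tgt : (Matrix (Fin 2) (Fin 2) ℂ)ˣ) : Matrix (Fin 2) (Fin 2) ℂ) with hKt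
  have hm' : HasDerivAt m (Ks * (D : Matrix (Fin 2) (Fin 2) ℂ)
      - (D : Matrix (Fin 2) (Fin 2) ℂ) * ((E : Matrix (Fin 2) (Fin 2) ℂ) * Kt * ((E⁻¹ : (Matrix (Fin 2) (Fin 2) ℂ)ˣ) : Matrix (Fin 2) (Fin 2) ℂ))) 0 := by
    have h1 := hk_s.mul_const (D : Matrix (Fin 2) (Fin 2) ℂ)
    have h2 := (hk_t.const_mul (E : Matrix (Fin 2) (Fin 2) ℂ)).mul_const ((E⁻¹ : (Matrix (Fin 2) (Fin 2) ℂ)ˣ) : Matrix (Fin 2) (Fin 2) ℂ)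
    have h3 := h1.mul h2
    have hk0s : (((vt 0 ĉ.src)⁻¹ * g 0 (embIter (K - n) ĉ.src) * v ĉ.src : (Matrix (Fin 2) (Fin 2) ℂ)ˣ) : Matrix (Fin 2) (Fin 2) ℂ) = 1 := by
      rw [k_zero (vt := fun t => vt t ĉ.src) (gt := fun t => g t (embIter (K - n) ĉ.src)) (hvt0 _) (hg0x _), Units.val_one]
    have hk0t : ((((vt 0 ĉ.tgt)⁻¹ * g 0 (embIter (K - n) ĉ.tgt) * v ĉ.tgt)⁻¹ : (Matrix (Fin 2) (Fin 2) ℂ)ˣ) : Matrix (Fin 2) (Fin 2) ℂ) = 1 := by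
      rw [k_zero (vt := fun t => vt t ĉ.tgt) (gt := fun t => g t (embIter (K - n) ĉ.tgt)) (hvt0 _) (hg0x _), inv_one, Units.val_one]
    have hfun : m = fun t => ((kt t ĉ.src : (Matrix (Fin 2) (Fin 2) ℂ)ˣ) : Matrix (Fin 2) (Fin 2) ℂ) * (D : Matrix (Fin 2) (Fin 2) ℂ)
        * ((E : Matrix (Fin 2) (Fin 2) ℂ) * (((kt t ĉ.tgt)⁻¹ : (Matrix (Fin 2) (Fin 2) ℂ)ˣ) : Matrix (Fin 2) (Fin 2) ℂ) * ((E⁻¹ : (Matrix (Fin 2) (Fin 2) ℂ)ˣ) : Matrix (Fin 2) (Fin 2) ℂ)) := rfl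
    rw [hfun]
    refine h3.congr_deriv ?_
    simp only [hk0s, hk0t, one_mul, mul_one, Units.mul_inv, mul_neg, neg_mul]
    noncomm_ring
  have hm0 : m 0 = (D : Matrix (Fin 2) (Fin 2) ℂ) := by
    simp only [hm, hkt]
    rw [k_zero (vt := fun t => vt t ĉ.src) (gt := fun t => g t (embIter (K - n) ĉ.src)) (hvt0 _) (hg0x _),
      k_zero (vt := fun t => vt t ĉ.tgt) (gt := fun t => g t (embIter (K - n) ĉ.tgt)) (hvt0 _) (hg0x _), inv_one, Units.val_one, one_mul, mul_one, Units.mul_inv, mul_one]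
  have hLm : HasFDerivAt (mlog : Matrix (Fin 2) (Fin 2) ℂ → Matrix (Fin 2) (Fin 2) ℂ) (L c) (m 0) := by rw [hm0]; exact hL c
  have hψ : HasDerivAt (fun t : ℝ => mlog (m t)) (L c (Ks * (D : Matrix (Fin 2) (Fin 2) ℂ)
      - (D : Matrix (Fin 2) (Fin 2) ℂ) * ((E : Matrix (Fin 2) (Fin 2) ℂ) * Kt * ((E⁻¹ : (Matrix (Fin 2) (Fin 2) ℂ)ˣ) : Matrix (Fin 2) (Fin 2) ℂ)))) 0 := by
    have hc' := (hLm.restrictScalars ℝ).comp_hasDerivAt (0 : ℝ) hm'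
    simpa only [Function.comp_def, ContinuousLinearMap.coe_restrictScalars'] using hc'
  -- (4) uniqueness of the derivative along the eventually-equal curves
  have hψ' : HasDerivAt (fun t : ℝ => logChartTwS F n K h U₀ (Ac t) c) (L c (Ks * (D : Matrix (Fin 2) (Fin 2) ℂ)
      - (D : Matrix (Fin 2) (Fin 2) ℂ) * ((E : Matrix (Fin 2) (Fin 2) ℂ) * Kt * ((E⁻¹ : (Matrix (Fin 2) (Fin 2) ℂ)ˣ) : Matrix (Fin 2) (Fin 2) ℂ)))) 0 :=
    hψ.congr_of_eventuallyEq hev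
  have huniq := hchain_c.unique hψ'
  rw [huniq]
  rfl

end Member

end Summit.QuantumFields.YangMills.Theorems.Prop7ChartGaugeCovarianceDeriv

end
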